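import Literature.Geometry.Lorentzian.CoordTensorCalculus
import Literature.Analysis.Calculus.MatrixFieldDeriv
import Mathlib.Analysis.Matrix.PosDef
import HarnessLib

/-!
# The Riemannian volume form in coordinates is parallel: `∇ε = 0`

Rank-generic coordinate tensor calculus (`CoordTensorCalculus.lean`: metric components `G` on
an open set `V` (`IsMetricOn G V`), basis `b` of the model space `E` indexed by `ι`, component
fields `T : E → (α → ι) → ℝ`, covariant derivative `tcov`, Christoffel symbols `chrCoef`,
inverse metric `ginv`). For RIEMANNIAN components (positive definite on `V`) we define

* `gramMatrix G b y = (G_y(b_i, b_k))_{ik}`, the volume density `sqrtDetGram G b y = √det(G_y(b_i,b_k))`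
  and **the volume form in components** `volForm G b : E → (ι → ι) → ℝ`,
  `ε_I(y) = √det(g(y)) · sgnDet I`, where `sgnDet I ∈ {0, ±1}` is the determinant of the `0/1`
  matrix `([I a = i])_{a i}` — the sign of `I` when `I` is a permutation and `0` otherwise (the
  Levi-Civita symbol; no order on `ι` is needed);

and prove

* `sum_sum_mul_sgnDet_update` — the infinitesimal `gl(n)`-invariance of the symbol:
  `Σ_a Σ_m X_{I_a m} sgnDet(I[a ↦ m]) = sgnDet(I) · tr X` (Laplace expansion along a replaced
  row, `Literature.Analysis.Calculus.det_updateRow_eq_sum_mul_adjugate`, and `adj P · P = det P`);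
* `IsMetricOn.sum_chrCoef_diag` — `Σ_m Γ^m_{jm} = ½ Σ_{m,d} g^{md} ∂_j g_{dm}` and
  `IsMetricOn.fderiv_sqrtDetGram` — **`∂_j √det g = √det g · Σ_m Γ^m_{jm}`** (Jacobi's formula,
  `Literature.Analysis.Calculus.hasFDerivAt_sqrt_det_apply`; O'Neill 1983, Ch. 7, Lemma 7.19 ff.:
  `div`, volume element; the classical `∂_j log √g = Γ^m_{jm}`);
* **`IsMetricOn.tcov_volForm` — `∇ε = 0` on `V`**: `(∇_j ε)_I = ∂_j ε_I − Σ_a Σ_m Γ^m_{j I_a} ε_{I[a↦m]}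
  = sgnDet(I)(∂_j √det g − √det g Σ_m Γ^m_{jm}) = 0` (O'Neill 1983, Ch. 7, Lemma 7.19 (2): the
  volume element of an oriented semi-Riemannian manifold is parallel);
* `IsMetricOn.tsmoothOn_volForm` (smoothness on `V`) and `volForm_apply_of_orthonormal`
  (`ε_I(x) = sgnDet I` in a `G_x`-orthonormal basis).

This is the input `∇⋆ = ⋆∇` for the self-dual/anti-self-dual decomposition of curvature tensors
in dimension four (Derdziński's Weitzenböck formula for `W⁺`, Gursky–LeBrun 1999, (1.3)).
Everything is proved; the definitions are explicit.

## References

* B. O'Neill, *Semi-Riemannian geometry*, Academic Press 1983, Ch. 3, Prop. 3.13 and p. 86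
  (`∇g = 0`, contractions); Ch. 7, Def. 7.18–Lemma 7.19 (volume element, parallel). [ONeill1983]
* J. R. Magnus, H. Neudecker, *Matrix Differential Calculus*, 3rd ed. 2019, Ch. 8, Thm. 8.1
  (Jacobi's formula). [MagnusNeudecker2019]
* M. J. Gursky, C. LeBrun, Ann. Global Anal. Geom. 17 (1999) 315–328, §2–§3. [GurskyLebrun1999]
-/

noncomputable section

open Set Filter Module Function Matrix
open scoped Topology ContDiff

namespace Literature.Geometry.Lorentzian

namespace MetricCoord

/-! ### The sign symbol `sgnDet` and its infinitesimal invariance -/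

section SgnDet

variable {ι : Type*} [Fintype ι] [DecidableEq ι]

/-- **The Levi-Civita symbol** of an index map `I : ι → ι`: the determinant of the `0/1` matrix
`([I a = i])_{a,i}` — `sign I` if `I` is a permutation, `0` otherwise. [folklore] -/
def sgnDet (I : ι → ι) : ℝ := (Matrix.of fun a i ↦ if I a = i then (1 : ℝ) else 0).det

/-- The `0/1` matrix of `I`. [folklore] -/
private def pmat (I : ι → ι) : Matrix ι ι ℝ := Matrix.of fun a i ↦ if I a = i then (1 : ℝ) else 0

omit [Fintype ι] in
/-- Updating the index map replaces one row of its `0/1` matrix. [folklore] -/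
private theorem pmat_update (I : ι → ι) (a m : ι) :
    pmat (update I a m) = (pmat I).updateRow a fun i ↦ if m = i then 1 else 0 := by
  ext a' i
  by_cases ha : a' = a
  · subst ha
    simp [pmat, Matrix.updateRow_self]
  · simp [pmat, Matrix.updateRow_ne ha, update_of_ne ha]

/-- `sgnDet (I[a ↦ m]) = adj(P_I)_{m a}` (Laplace expansion along the replaced row).
[folklore] -/
theorem sgnDet_update (I : ι → ι) (a m : ι) :
    sgnDet (update I a m) = (Matrix.of fun a i ↦ if I a = i then (1 : ℝ) else 0).adjugate m a := by
  change (pmat (update I a m)).det = (pmat I).adjugate m a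
  rw [pmat_update, Literature.Analysis.Calculus.det_updateRow_eq_sum_mul_adjugate]
  simp only [ite_mul, one_mul, zero_mul, Finset.sum_ite_eq, Finset.mem_univ, if_true]

/-- The identity matrix on the diagonal of `I`: `sgnDet id = 1`. [folklore] -/
theorem sgnDet_id : sgnDet (id : ι → ι) = 1 := by
  unfold sgnDet
  have h : (Matrix.of fun a i : ι ↦ if id a = i then (1 : ℝ) else 0) = 1 := by
    ext a i
    simp [Matrix.one_apply]
  rw [h, det_one]

/-- **Infinitesimal invariance of the Levi-Civita symbol**: for every `X : ι → ι → ℝ` and `I`,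
`Σ_a Σ_m X_{I_a m} · sgnDet (I[a ↦ m]) = sgnDet I · Σ_m X_{mm}` — the derived action of `gl(n)` on
top forms is multiplication by the trace (`adj P · P = det P · 1`). [folklore] -/
theorem sum_sum_mul_sgnDet_update (X : ι → ι → ℝ) (I : ι → ι) :
    ∑ a, ∑ m, X (I a) m * sgnDet (update I a m) = sgnDet I * ∑ m, X m m := by
  have hPX : ∀ a m, (pmat I * Matrix.of X) a m = X (I a) m := by
    intro a m
    simp only [pmat, Matrix.mul_apply, Matrix.of_apply, ite_mul, one_mul, zero_mul,
      Finset.sum_ite_eq, Finset.mem_univ, if_true]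
  calc ∑ a, ∑ m, X (I a) m * sgnDet (update I a m)
      = ∑ a, ∑ m, (pmat I * Matrix.of X) a m * (pmat I).adjugate m a := by
        simp only [sgnDet_update, hPX]
        rfl
    _ = (pmat I * Matrix.of X * (pmat I).adjugate).trace := by
        simp only [Matrix.trace, Matrix.diag_apply, Matrix.mul_apply]
    _ = (Matrix.of X * ((pmat I).adjugate * pmat I)).trace := by
        rw [Matrix.mul_assoc, Matrix.trace_mul_comm, Matrix.mul_assoc]
    _ = sgnDet I * ∑ m, X m m := by
        rw [Matrix.adjugate_mul, Matrix.mul_smul, Matrix.mul_one, Matrix.trace_smul, smul_eq_mul]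
        simp only [Matrix.trace, Matrix.diag_apply, Matrix.of_apply]
        rfl

end SgnDet

/-! ### Gram matrix, volume density and volume form of metric components -/

section Defs

variable {E : Type*} [NormedAddCommGroup E] [NormedSpace ℝ E] {ι : Type*} [Fintype ι]
  [DecidableEq ι] (G : E → E →L[ℝ] E →L[ℝ] ℝ) (b : Basis ι ℝ E)

/-- The Gram matrix field `(G_y(b_i, b_k))_{ik}`. [cite: ONeill1983, Ch. 3, Lemma 3.4] -/
def gramMatrix (y : E) : Matrix ι ι ℝ := Matrix.of fun i k ↦ G y (b i) (b k)

/-- The **volume density** `√det(G_y(b_i, b_k))`. [cite: ONeill1983, Ch. 7, Def. 7.18] -/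
def sqrtDetGram (y : E) : ℝ := Real.sqrt (gramMatrix G b y).det

/-- **The volume form in components**: `ε_I(y) = √det(g(y)) · sgnDet I` — for a permutation `I`
the value of the metric volume form of the orientation of `b` on `(b_{I 0}, …, b_{I (n-1)})`,
zero on repeated indices. [cite: ONeill1983, Ch. 7, Def. 7.18–Lemma 7.19] -/
def volForm : E → (ι → ι) → ℝ := fun y I ↦ sqrtDetGram G b y * sgnDet I

/-- Unfolding lemma. [cite: ONeill1983, Ch. 7, Def. 7.18] -/
theorem volForm_apply (y : E) (I : ι → ι) : volForm G b y I = sqrtDetGram G b y * sgnDet I := rfl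

end Defs

/-! ### Positivity, the inverse Gram matrix and the derivative of the density -/

section Density

variable {E : Type*} [NormedAddCommGroup E] [NormedSpace ℝ E] {ι : Type*} [Fintype ι]
  [DecidableEq ι] {G : E → E →L[ℝ] E →L[ℝ] ℝ} (b : Basis ι ℝ E) {V : Set E} {x : E}

omit [DecidableEq ι] in
/-- The Gram matrix of a basis for a positive definite symmetric form is positive definite.
[folklore] -/
theorem posDef_gramMatrix (hs : ∀ v w : E, G x v w = G x w v) (hpos : ∀ v : E, v ≠ 0 → 0 < G x v v) :
    Matrix.PosDef (gramMatrix G b x) := by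
  refine Matrix.PosDef.of_dotProduct_mulVec_pos (Matrix.IsHermitian.ext fun i k ↦ ?_) fun c hc ↦ ?_
  · simp [gramMatrix, hs (b k) (b i)]
  · have hv : (∑ i, c i • b i) ≠ 0 := by
      intro h0
      apply hc
      funext i
      exact Fintype.linearIndependent_iff.1 b.linearIndependent c h0 i
    have hq : star c ⬝ᵥ (gramMatrix G b x).mulVec c = G x (∑ i, c i • b i) (∑ i, c i • b i) := by
      simp only [star_trivial, dotProduct, Matrix.mulVec, gramMatrix, Matrix.of_apply, map_sum,
        map_smul, _root_.sum_apply, _root_.smul_apply, smul_eq_mul, Finset.mul_sum]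
      exact Finset.sum_congr rfl fun i _ ↦ Finset.sum_congr rfl fun k _ ↦ by rw [hs (b k) (b i)]; ring
    rw [hq]
    exact hpos _ hv

/-- The Gram determinant of Riemannian components is positive. [folklore] -/
theorem det_gramMatrix_pos (hs : ∀ v w : E, G x v w = G x w v) (hpos : ∀ v : E, v ≠ 0 → 0 < G x v v) :
    0 < (gramMatrix G b x).det :=
  (posDef_gramMatrix b hs hpos).det_pos

variable [FiniteDimensional ℝ E]

/-- **`g^{ij}` is the inverse Gram matrix** (a private copy of `ginv_eq_inv` of
`LaplaceBeltramiChartForm.lean`, not imported here). [cite: ONeill1983, Ch. 3, Lemma 3.4] -/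
private theorem ginv_eq_inv' (hx : (G x).IsInvertible) (hs : ∀ v w : E, G x v w = G x w v) (i j : ι) :
    ginv G b x i j = (gramMatrix G b x)⁻¹ i j := by
  set A : Matrix ι ι ℝ := gramMatrix G b x with hA
  set B : Matrix ι ι ℝ := Matrix.of fun i j ↦ ginv G b x i j with hB
  have hBA : B * A = 1 := by
    ext i k
    rw [Matrix.mul_apply, Matrix.one_apply]
    have h := coord_eq_sum_ginv b hx (b k) i
    rw [Basis.coord_apply, b.repr_self, Finsupp.single_apply] at h
    simp only [hA, hB, gramMatrix, Matrix.of_apply]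
    calc ∑ j, ginv G b x i j * G x (b j) (b k) = ∑ j, ginv G b x i j * G x (b k) (b j) :=
          Finset.sum_congr rfl fun j _ ↦ by rw [hs (b j) (b k)]
      _ = if k = i then 1 else 0 := h.symm
      _ = if i = k then 1 else 0 := by
          rcases eq_or_ne k i with h' | h'
          · subst h'; simp
          · simp [h', Ne.symm h']
  have hinv : A⁻¹ = B := Matrix.inv_eq_left_inv hBA
  rw [hinv, hB, Matrix.of_apply]

omit [DecidableEq ι] [FiniteDimensional ℝ E] in
/-- The Gram matrix field as rows, and its derivative `v ↦ ((∂_v G)(b_i, b_k))_{ik}`. [folklore] -/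
theorem IsMetricOn.hasFDerivAt_gramRows (hG : IsMetricOn G V) (hx : x ∈ V) :
    HasFDerivAt (fun y ↦ fun i k ↦ G y (b i) (b k))
      (ContinuousLinearMap.pi fun i ↦ ContinuousLinearMap.pi fun k ↦
        ((fderiv ℝ G x).flip (b i)).flip (b k)) x := by
  refine hasFDerivAt_pi.2 fun i ↦ hasFDerivAt_pi.2 fun k ↦ ?_
  have h := (hG.differentiableAt hx).hasFDerivAt
  have h1 : HasFDerivAt (fun y ↦ G y (b i)) ((fderiv ℝ G x).flip (b i)) x :=
    (h.clm_apply (hasFDerivAt_const (b i) x)).congr_fderiv (by simp)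
  exact (h1.clm_apply (hasFDerivAt_const (b k) x)).congr_fderiv (by simp)

omit [DecidableEq ι] in
/-- **`Σ_m Γ^m_{jm} = ½ Σ_{m,d} g^{md} ∂_j g_{dm}`** (`∂_j g_{dm} = g(Γ_j b_d, b_m) + g(b_d, Γ_j b_m)`
and the symmetry of `g`, `g⁻¹`). [cite: ONeill1983, Ch. 3, Prop. 3.13] -/
theorem IsMetricOn.sum_chrCoef_diag [CompleteSpace E] (hG : IsMetricOn G V) (hx : x ∈ V) (j : ι) :
    ∑ m, chrCoef G b x j m m =
      2⁻¹ * ∑ m, ∑ d, ginv G b x m d * fderiv ℝ G x (b j) (b d) (b m) := by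
  have hi := hG.isInvertible x hx
  have hs := hG.symm x hx
  have hgs : ∀ p q, ginv G b x p q = ginv G b x q p := fun p q ↦ ginv_comm b hi hs p q
  have h1 : ∑ m, chrCoef G b x j m m = ∑ m, ∑ d, ginv G b x m d * G x (chrAt G x (b j) (b m)) (b d) :=
    Finset.sum_congr rfl fun m _ ↦ chrCoef_eq_sum_ginv b hi j m m
  have h2 : ∑ m, ∑ d, ginv G b x m d * fderiv ℝ G x (b j) (b d) (b m) =
      ∑ m, ∑ d, ginv G b x m d * G x (chrAt G x (b j) (b d)) (b m) +
        ∑ m, ∑ d, ginv G b x m d * G x (chrAt G x (b j) (b m)) (b d) := by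
    rw [← Finset.sum_add_distrib]
    refine Finset.sum_congr rfl fun m _ ↦ ?_
    rw [← Finset.sum_add_distrib]
    refine Finset.sum_congr rfl fun d _ ↦ ?_
    rw [hG.fderiv_eq_chrAt hx (b j) (b d) (b m), hs (b d) (chrAt G x (b j) (b m))]
    ring
  have h3 : ∑ m, ∑ d, ginv G b x m d * G x (chrAt G x (b j) (b d)) (b m) =
      ∑ m, ∑ d, ginv G b x m d * G x (chrAt G x (b j) (b m)) (b d) := by
    rw [Finset.sum_comm]
    exact Finset.sum_congr rfl fun m _ ↦ Finset.sum_congr rfl fun d _ ↦ by rw [hgs d m]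
  rw [h1, h2, h3]
  ring

/-- **`∂_j √det g = √det g · Σ_m Γ^m_{jm}`** (Jacobi's formula
`d√det A (v) = ½ √det A · tr(A⁻¹ A'v)`, `hasFDerivAt_sqrt_det_apply`, with `A⁻¹ = (g^{ij})` and
`sum_chrCoef_diag`). [cite: MagnusNeudecker2019, Ch. 8 Thm. 8.1] [cite: ONeill1983, Ch. 7, Lemma 7.19] -/
theorem IsMetricOn.fderiv_sqrtDetGram [CompleteSpace E] (hG : IsMetricOn G V) (hx : x ∈ V)
    (hpos : ∀ v : E, v ≠ 0 → 0 < G x v v) (j : ι) :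
    fderiv ℝ (sqrtDetGram G b) x (b j) = sqrtDetGram G b x * ∑ m, chrCoef G b x j m m := by
  have hi := hG.isInvertible x hx
  have hs := hG.symm x hx
  have hdet : 0 < (Matrix.of fun i k ↦ G x (b i) (b k)).det := det_gramMatrix_pos b hs hpos
  have h := Literature.Analysis.Calculus.hasFDerivAt_sqrt_det_apply (hG.hasFDerivAt_gramRows b hx)
    hdet (b j)
  have hfun : (fun z ↦ Real.sqrt (Matrix.of fun i k ↦ G z (b i) (b k)).det) = sqrtDetGram G b := rfl
  rw [hfun] at h
  rw [h, hG.sum_chrCoef_diag b hx j]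
  have htr : ((Matrix.of fun i k ↦ G x (b i) (b k))⁻¹ *
      Matrix.of ((ContinuousLinearMap.pi fun i ↦ ContinuousLinearMap.pi fun k ↦
        ((fderiv ℝ G x).flip (b i)).flip (b k)) (b j))).trace =
      ∑ m, ∑ d, ginv G b x m d * fderiv ℝ G x (b j) (b d) (b m) := by
    simp only [Matrix.trace, Matrix.diag_apply, Matrix.mul_apply, Matrix.of_apply,
      ContinuousLinearMap.pi_apply, ContinuousLinearMap.flip_apply]
    refine Finset.sum_congr rfl fun m _ ↦ Finset.sum_congr rfl fun d _ ↦ ?_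
    rw [ginv_eq_inv' b hi hs m d]
    rfl
  rw [htr]
  change 2⁻¹ * sqrtDetGram G b x * _ = _
  ring

end Density

/-! ### `∇ε = 0` -/

section Parallel

variable {E : Type*} [NormedAddCommGroup E] [NormedSpace ℝ E] {ι : Type*} [Fintype ι]
  [DecidableEq ι] {G : E → E →L[ℝ] E →L[ℝ] ℝ} (b : Basis ι ℝ E) {V : Set E} {x : E}
  [FiniteDimensional ℝ E] [CompleteSpace E]

/-- **The volume form is parallel**: `(∇_j ε)_I = 0` at every point of `V` for Riemannian
components (O'Neill 1983, Ch. 7, Lemma 7.19 (2)). Indeed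
`(∇_j ε)_I = ∂_j ε_I − Σ_a Σ_m Γ^m_{j I_a} ε_{I[a↦m]} = sgnDet I · (∂_j √det g − √det g · Σ_m Γ^m_{jm}) = 0`
(`sum_sum_mul_sgnDet_update`, `fderiv_sqrtDetGram`). [cite: ONeill1983, Ch. 7, Lemma 7.19] -/
theorem IsMetricOn.tcov_volForm (hG : IsMetricOn G V) (hx : x ∈ V)
    (hpos : ∀ v : E, v ≠ 0 → 0 < G x v v) (J : Option ι → ι) : tcov G b (volForm G b) x J = 0 := by
  rw [tcov_apply]
  have hd : DifferentiableAt ℝ (sqrtDetGram G b) x := by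
    have hs := hG.symm x hx
    have hdet : 0 < (Matrix.of fun i k ↦ G x (b i) (b k)).det := det_gramMatrix_pos b hs hpos
    exact (Literature.Analysis.Calculus.hasFDerivAt_sqrt_det (hG.hasFDerivAt_gramRows b hx)
      hdet).differentiableAt
  have h1 : fderiv ℝ (fun y ↦ volForm G b y (J ∘ some)) x (b (J none)) =
      sqrtDetGram G b x * (∑ m, chrCoef G b x (J none) m m) * sgnDet (J ∘ some) := by
    simp only [volForm_apply]
    rw [fderiv_mul_const hd, _root_.smul_apply, smul_eq_mul, hG.fderiv_sqrtDetGram b hx hpos]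
    ring
  have h2 : ∑ a, ∑ m, chrCoef G b x (J none) (J (some a)) m * volForm G b x (update (J ∘ some) a m) =
      sqrtDetGram G b x * (sgnDet (J ∘ some) * ∑ m, chrCoef G b x (J none) m m) := by
    simp only [volForm_apply]
    rw [← sum_sum_mul_sgnDet_update (fun i m ↦ chrCoef G b x (J none) i m) (J ∘ some), Finset.mul_sum]
    refine Finset.sum_congr rfl fun a _ ↦ ?_
    rw [Finset.mul_sum]
    refine Finset.sum_congr rfl fun m _ ↦ ?_
    simp only [Function.comp_apply]
    ring
  rw [h1, h2]
  ring

omit [FiniteDimensional ℝ E] [CompleteSpace E] in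
/-- The volume density is `C^∞` on `V` for Riemannian components. [folklore] -/
theorem IsMetricOn.contDiffOn_sqrtDetGram (hG : IsMetricOn G V)
    (hpos : ∀ y ∈ V, ∀ v : E, v ≠ 0 → 0 < G y v v) : ContDiffOn ℝ ∞ (sqrtDetGram G b) V := by
  have hdet : ContDiffOn ℝ ∞ (fun y ↦ (gramMatrix G b y).det) V := by
    simp only [Matrix.det_apply', gramMatrix, Matrix.of_apply]
    refine ContDiffOn.sum fun σ _ ↦ ?_
    refine contDiffOn_const.mul (contDiffOn_prod fun i _ ↦ ?_)
    exact (hG.contDiffOn.clm_apply contDiffOn_const).clm_apply contDiffOn_const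
  intro y hy
  exact (hdet y hy).sqrt (det_gramMatrix_pos b (hG.symm y hy) (hpos y hy)).ne'

omit [FiniteDimensional ℝ E] [CompleteSpace E] in
/-- **The volume form is a smooth component field on `V`.** [folklore] -/
theorem IsMetricOn.tsmoothOn_volForm (hG : IsMetricOn G V)
    (hpos : ∀ y ∈ V, ∀ v : E, v ≠ 0 → 0 < G y v v) : TSmoothOn (volForm G b) V :=
  fun _ ↦ (hG.contDiffOn_sqrtDetGram b hpos).mul contDiffOn_const

omit [FiniteDimensional ℝ E] [CompleteSpace E] in
/-- In a `G_x`-ORTHONORMAL basis the density is `1` and `ε_I(x) = sgnDet I`. [folklore] -/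
theorem volForm_apply_of_orthonormal (hb : ∀ i k, G x (b i) (b k) = if i = k then 1 else 0)
    (I : ι → ι) : volForm G b x I = sgnDet I := by
  have h : gramMatrix G b x = 1 := by
    ext i k
    simp [gramMatrix, hb, Matrix.one_apply]
  rw [volForm_apply, sqrtDetGram, h, det_one, Real.sqrt_one, one_mul]

end Parallel

end MetricCoord

end Literature.Geometry.Lorentzian

end
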